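import Summits.Schanuel.Schanuel.Theorems.RootDecomp1KKummerClosure04

/-!
# RootDecomp1KKummerClosure («KUMMER CLOSURE», lens 6 gen 12/13 = 1K ROUND 9) — continuation (RootDecomp1KKummerClosure05): §K6 INSTANCE LOG: λ with e^λ = α ∈ ℚ̄^× (λ ≠ 0) has finite transcendence type mod NW96 Thm 1 (binder hNW; finiteTranscendenceType_log, log_approx) and, in one screen, mod the Literature hypothesis W78LogMeasure (finiteTranscendenceType_log_of_W78)

Part of the six-file split (400-line rule) of lens 6's node «KUMMER CLOSURE» = HOME/decomp-schanuel-lens-6/g13/addendum/KummerClosure.lean (v2, sha256 6dd432d1…, 1650 l;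
= g12 v1 6d5e0790… with the engine re-cut into engine_lower / engine_upper at the census's request, every statement byte-identical; 1K ROUND 9 THEOREM ROUND on the critic's
round-9 ACCEPTED-NEXT (i‴) «general Kummer closure with the UNIFORM degree bound»; `--supports stmt-Schanuel-33363`). Shared namespace
`Summit.Schanuel.Schanuel.Theorems.RootDecomp1KKummerClosure`; the node docstring is in part 01; K4's one-line copies of tree-private lemmas are private here.
Facts enter as hypotheses only (hNW : NesterenkoWaldschmidt1996_thm_1, hlm : Literature.Uncategorized.W78LogMeasure). Sorry-free; standard axioms. Nothing here proves Schanuel; rung 0.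
-/

open Polynomial Complex IntermediateField
open Summit.Schanuel.Schanuel.Theorems.RootDecomp1KHyper
open Summit.Schanuel.Schanuel.Theorems.RootDecomp1KHyper.HyperCell
open Summit.Schanuel.Schanuel.Theorems.RootDecomp1KRadical

noncomputable section

namespace Summit.Schanuel.Schanuel.Theorems.RootDecomp1KKummerClosure

/-- `Real.log x ≤ x`. -/
private theorem log_le_self_of_pos' {x : ℝ} (hx : 0 < x) : Real.log x ≤ x := by
  have := Real.log_le_sub_one_of_pos hx; linarith

/-- The Mahler measure of a non-zero integer polynomial (mapped to `ℂ`) is at least `1` (private copy of a tree-private wave lemma). -/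
private theorem one_le_mahlerMeasure_map_of_ne_zero' {R : ℤ[X]} (hR : R ≠ 0) :
    1 ≤ (R.map (Int.castRingHom ℂ)).mahlerMeasure := by
  refine one_le_mahlerMeasure_of_one_le_norm_leadingCoeff ?_
  rw [Polynomial.leadingCoeff_map_of_injective (RingHom.injective_int _), eq_intCast,
    Complex.norm_intCast]
  exact_mod_cast Int.one_le_abs (Polynomial.leadingCoeff_ne_zero.mpr hR)

/-! ## K6. INSTANCE LOG: `λ` with `e^λ = α ∈ ℚ̄^×` (`λ ≠ 0`: any non-zero logarithm of an algebraic
number) has finite transcendence type — mod NW96 Thm 1 (registered Literature fact); and, in one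
screen, mod W78 Cor. 3.7 (`W78LogMeasure`, vendored hypothesis) -/

section LogInstance
open Literature.NumberTheory.Transcendental

/-! #### (W) mod `W78LogMeasure` -/

/-- W78's exponent: `C N² (log H + N log N)/(1 + log N) ≤ C (N + log H)^4`. -/
theorem w78log_exponent_le {C : ℝ} {N H : ℕ} (hC : 0 ≤ C) (hN : 1 ≤ N) (hH : 16 ≤ H) :
    C * (N : ℝ) ^ 2 * (Real.log H + N * Real.log N) / (1 + Real.log N) ≤
      C * ((N : ℝ) + Real.log H) ^ 4 := by
  have hN1 : (1 : ℝ) ≤ N := by exact_mod_cast hN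
  have hH16 : (16 : ℝ) ≤ H := by exact_mod_cast hH
  have hlogH0 : 0 ≤ Real.log H := Real.log_nonneg (by linarith)
  have hlogN0 : 0 ≤ Real.log N := Real.log_nonneg hN1
  have hlogN : Real.log N ≤ N := log_le_self_of_pos' (by linarith)
  have hnum0 : 0 ≤ C * (N : ℝ) ^ 2 * (Real.log H + N * Real.log N) := by positivity
  have hden1 : 1 ≤ 1 + Real.log N := by linarith
  refine (div_le_self hnum0 hden1).trans ?_
  have a1 : (N : ℝ) ^ 2 ≤ ((N : ℝ) + Real.log H) ^ 2 :=
    pow_le_pow_left₀ (by linarith) (by linarith) 2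
  have a2 : Real.log H + N * Real.log N ≤ ((N : ℝ) + Real.log H) ^ 2 := by
    have : (N : ℝ) * Real.log N ≤ N * N := mul_le_mul_of_nonneg_left hlogN (by linarith)
    nlinarith
  calc C * (N : ℝ) ^ 2 * (Real.log H + N * Real.log N)
      ≤ C * ((N : ℝ) + Real.log H) ^ 2 * ((N : ℝ) + Real.log H) ^ 2 :=
        mul_le_mul (mul_le_mul_of_nonneg_left a1 hC) a2 (by positivity) (by positivity)
    _ = C * ((N : ℝ) + Real.log H) ^ 4 := by ring

/-- **Instance LOG (W).** mod `W78LogMeasure` (Waldschmidt 1978 Cor. 3.7, vendored hypothesis):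
`λ ≠ 0` with `e^λ` algebraic has finite transcendence type (`τ = 4`). -/
theorem finiteTranscendenceType_log_of_W78 (hlm : Literature.Uncategorized.W78LogMeasure) {lam : ℂ}
    (h0 : lam ≠ 0) (halg : IsAlgebraic ℚ (cexp lam)) : FiniteTranscendenceType lam := by
  obtain ⟨C, hC, hall⟩ := hlm lam h0 halg
  refine ⟨C, 4, hC, fun S N H hS hN hdeg hH hcoef => ?_⟩
  refine le_trans (Real.exp_le_exp.mpr ?_) (hall S N H hS hN hdeg hH hcoef)
  rw [neg_le_neg_iff]
  exact w78log_exponent_le hC.le hN hH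

/-! #### (NW) mod NW 1996 Theorem 1 — the registered fact -/

/-- `2 * Real.exp 1 < 6`. -/
private theorem two_e_lt_six : 2 * Real.exp 1 < 6 := by
  have := Real.exp_one_lt_d9; linarith

/-- the (crude, polynomial) approximation exponent for `λ = log α`: `n = deg α`,
`a = log M(A) + 1`, `T = |λ|`, `ℓ = |log |λ||` -/
noncomputable def lphi (n : ℕ) (a T ℓ : ℝ) (d L : ℕ) : ℝ :=
  211 * ((n : ℝ) * d) * (Real.log L + Real.log a + 4 * ((n : ℝ) * d) + 2 * T + 12) *
    (((n : ℝ) * d) * a + 6 * T + 6) * (33 / 10 * ((n : ℝ) * d) * ((n : ℝ) * d + 1) + 1) + 1 + ℓ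

/-- §K6. The approximation exponent `lphi` is non-negative on its domain. -/
theorem lphi_nonneg (n : ℕ) {a T ℓ : ℝ} (ha : 1 ≤ a) (hT : 0 ≤ T) (hℓ : 0 ≤ ℓ) (d L : ℕ) :
    0 ≤ lphi n a T ℓ d L := by
  unfold lphi
  have : 0 ≤ Real.log L := Real.log_natCast_nonneg L
  have : 0 ≤ Real.log a := Real.log_nonneg ha
  have : (0 : ℝ) ≤ a := by linarith
  positivity

/-- §K6. The approximation exponent `lphi` is monotone in the degree parameter. -/
theorem lphi_mono (n : ℕ) {a T ℓ : ℝ} (ha : 1 ≤ a) (hT : 0 ≤ T) (_hℓ : 0 ≤ ℓ) {m d : ℕ} (L : ℕ)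
    (h : m ≤ d) : lphi n a T ℓ m L ≤ lphi n a T ℓ d L := by
  unfold lphi
  have hL : 0 ≤ Real.log L := Real.log_natCast_nonneg L
  have hla : 0 ≤ Real.log a := Real.log_nonneg ha
  have ha0 : (0 : ℝ) ≤ a := by linarith
  have h' : (m : ℝ) ≤ d := by exact_mod_cast h
  have hm0 : (0 : ℝ) ≤ m := Nat.cast_nonneg m
  have hn0 : (0 : ℝ) ≤ n := Nat.cast_nonneg n
  gcongr

set_option maxHeartbeats 800000 in
/-- **Approximation measure for `λ`, `e^λ = α ∈ ℚ̄` (mod NW 1996 Thm 1).**  Theorem 1 at `θ = λ`,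
`α = e^λ`, `β = ξ`, `A = e^a` (`a = log M(A_α) + 1 ≥ max(h(α), 1/D)`), `B = L`, `E = e`: the term
`|e^θ − α|` VANISHES, leaving `|λ − ξ| ≥ exp(−…)`. -/
theorem log_approx (hNW : NesterenkoWaldschmidt1996_thm_1) {lam : ℂ} (h0 : lam ≠ 0)
    {A : ℤ[X]} (hAirr : Irreducible A) (hAdeg : 0 < A.natDegree) (hAα : aeval (cexp lam) A = 0)
    (Q : ℤ[X]) (ξ : ℂ) (L : ℕ) (hQ : Irreducible Q) (hd : 0 < Q.natDegree) (hξ : aeval ξ Q = 0)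
    (hlen : (∑ k ∈ Finset.range (Q.natDegree + 1), |Q.coeff k|) ≤ (L : ℤ)) (hL : 3 ≤ L) :
    Real.exp (-(Q.natDegree * lphi A.natDegree
      (Real.log (A.map (Int.castRingHom ℂ)).mahlerMeasure + 1) ‖lam‖ |Real.log ‖lam‖|
      Q.natDegree L)) ≤ ‖lam - ξ‖ := by
  obtain ⟨a, ha⟩ : ∃ a : ℝ, a = Real.log (A.map (Int.castRingHom ℂ)).mahlerMeasure + 1 := ⟨_, rfl⟩
  rw [← ha]
  set n : ℕ := A.natDegree with hn
  set d : ℕ := Q.natDegree with hdd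
  have hMA1 : 1 ≤ (A.map (Int.castRingHom ℂ)).mahlerMeasure :=
    one_le_mahlerMeasure_map_of_ne_zero' hAirr.ne_zero
  have hlMA0 : 0 ≤ Real.log (A.map (Int.castRingHom ℂ)).mahlerMeasure := Real.log_nonneg hMA1
  have ha1 : 1 ≤ a := by rw [ha]; linarith
  have ha0 : 0 < a := by linarith
  have hla0 : 0 ≤ Real.log a := Real.log_nonneg ha1
  have hT0 : 0 ≤ ‖lam‖ := norm_nonneg _
  have hTpos : 0 < ‖lam‖ := norm_pos_iff.mpr h0
  have hℓ0 : 0 ≤ |Real.log ‖lam‖| := abs_nonneg _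
  have hd1 : (1 : ℝ) ≤ d := by exact_mod_cast hd
  have hd0 : (0 : ℝ) < d := by linarith
  have hn1 : (1 : ℝ) ≤ n := by exact_mod_cast hAdeg
  have hL3 : (3 : ℝ) ≤ L := by exact_mod_cast hL
  have hL0 : (0 : ℝ) < L := by linarith
  have hlogL : 0 ≤ Real.log L := Real.log_natCast_nonneg L
  have hnd1 : (1 : ℝ) ≤ (n : ℝ) * d := one_le_mul_of_one_le_of_one_le hn1 hd1
  -- the main product term is `≥ 0`, so `d·lphi ≥ 1 + ℓ`
  have hmain0 : 0 ≤ 211 * ((n : ℝ) * d) *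
      (Real.log L + Real.log a + 4 * ((n : ℝ) * d) + 2 * ‖lam‖ + 12) *
      (((n : ℝ) * d) * a + 6 * ‖lam‖ + 6) * (33 / 10 * ((n : ℝ) * d) * ((n : ℝ) * d + 1) + 1) := by
    positivity
  have hφ0 : 0 ≤ lphi n a ‖lam‖ |Real.log ‖lam‖| d L := lphi_nonneg n ha1 hT0 hℓ0 d L
  have hφd : lphi n a ‖lam‖ |Real.log ‖lam‖| d L ≤ (d : ℝ) * lphi n a ‖lam‖ |Real.log ‖lam‖| d L :=
    le_mul_of_one_le_left hφ0 hd1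
  have hbig : |Real.log ‖lam‖| + 1 ≤ (d : ℝ) * lphi n a ‖lam‖ |Real.log ‖lam‖| d L := by
    have h1 : |Real.log ‖lam‖| + 1 ≤ lphi n a ‖lam‖ |Real.log ‖lam‖| d L := by unfold lphi; linarith
    linarith
  by_cases hξ0 : ξ = 0
  · rw [hξ0, sub_zero]
    have h1 : Real.exp (-((d : ℝ) * lphi n a ‖lam‖ |Real.log ‖lam‖| d L)) ≤
        Real.exp (Real.log ‖lam‖) :=
      Real.exp_le_exp.mpr (by linarith [neg_abs_le (Real.log ‖lam‖)])
    rwa [Real.exp_log hTpos] at h1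
  -- Theorem 1 at `θ = λ`, `α = e^λ`, `β = ξ`, `A = e^a`, `B = L`, `E = e`
  obtain ⟨hαalg, hξalg, hD1, hDle, hhα, hhξ⟩ := pair_bounds Q hQ hd hξ A hAirr.ne_zero hAα
  set D : ℕ := Module.finrank ℚ (IntermediateField.adjoin ℚ ({cexp lam, ξ} : Set ℂ)) with hDdef
  have hMQ1 : 1 ≤ (Q.map (Int.castRingHom ℂ)).mahlerMeasure :=
    one_le_mahlerMeasure_map_of_ne_zero' hQ.ne_zero
  have hMQL : (Q.map (Int.castRingHom ℂ)).mahlerMeasure ≤ L := by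
    refine (NesterenkoWaldschmidt1996.mahlerMeasure_le_length Q).trans ?_
    exact_mod_cast hlen
  have hh : weilHeight₁ (IntermediateField.adjoin ℚ ({cexp lam, ξ} : Set ℂ)) (fun _ : Unit => ξ) ≤
      Real.log L := hhξ.trans (Real.log_le_log (by linarith) hMQL)
  have hDr1 : (1 : ℝ) ≤ D := by exact_mod_cast hD1
  have hDr0 : (0 : ℝ) < D := by linarith
  have hAcond : max (weilHeight₁ (IntermediateField.adjoin ℚ ({cexp lam, ξ} : Set ℂ))
      (fun _ : Unit => cexp lam)) (1 / (D : ℝ)) ≤ Real.log (Real.exp a) := by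
    rw [Real.log_exp]
    refine max_le (hhα.trans (by rw [ha]; linarith)) ?_
    rw [div_le_iff₀ hDr0]; nlinarith
  have hmain := hNW lam (cexp lam) ξ (Real.exp a) L (Real.exp 1) h0 (Complex.exp_ne_zero _) hξ0
    hαalg hξalg (Real.exp_pos a) hL0 le_rfl hAcond hh
  rw [← hDdef] at hmain
  simp only [Real.log_exp, sub_self, norm_zero, zero_add, one_pow, div_one, mul_one] at hmain
  refine le_trans (Real.exp_le_exp.mpr ?_) hmain
  rw [neg_le_neg_iff]
  -- the three factors
  have hDX : (D : ℝ) ≤ (n : ℝ) * d := by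
    have : (D : ℝ) ≤ ((A.natDegree * Q.natDegree : ℕ) : ℝ) := by exact_mod_cast hDle
    push_cast at this
    exact this
  have hlogD : Real.log D ≤ (n : ℝ) * d := by
    have := Real.log_le_sub_one_of_pos hDr0; linarith
  have hlogD0 : 0 ≤ Real.log D := Real.log_nonneg hDr1
  have hlogD2 : Real.log ((D : ℝ) + 2) ≤ (n : ℝ) * d + 1 := by
    have := Real.log_le_sub_one_of_pos (by linarith : (0 : ℝ) < D + 2); linarith
  have hlogD20 : 0 ≤ Real.log ((D : ℝ) + 2) := Real.log_nonneg (by linarith)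
  have hmax1 : 1 ≤ max 1 ‖lam‖ := le_max_left _ _
  have hmaxT : max 1 ‖lam‖ ≤ 1 + ‖lam‖ := max_le (by linarith) (by linarith)
  have he1 : (1 : ℝ) ≤ Real.exp 1 := by have := Real.add_one_le_exp (1 : ℝ); linarith
  have hlogE : Real.log (Real.exp 1 * max 1 ‖lam‖) ≤ 1 + ‖lam‖ := by
    rw [Real.log_mul (Real.exp_pos 1).ne' (by linarith), Real.log_exp]
    have := Real.log_le_sub_one_of_pos (by linarith : (0 : ℝ) < max 1 ‖lam‖)
    linarith
  have hlogE0 : 0 ≤ Real.log (Real.exp 1 * max 1 ‖lam‖) :=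
    Real.log_nonneg (one_le_mul_of_one_le_of_one_le he1 hmax1)
  have f1 : Real.log L + Real.log a + 4 * Real.log D + 2 * Real.log (Real.exp 1 * max 1 ‖lam‖) + 10 ≤
      Real.log L + Real.log a + 4 * ((n : ℝ) * d) + 2 * ‖lam‖ + 12 := by linarith
  have f1pos : 0 ≤ Real.log L + Real.log a + 4 * Real.log D +
      2 * Real.log (Real.exp 1 * max 1 ‖lam‖) + 10 := by positivity
  have f2 : (D : ℝ) * a + 2 * Real.exp 1 * ‖lam‖ + 6 ≤ ((n : ℝ) * d) * a + 6 * ‖lam‖ + 6 := by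
    have a' := mul_le_mul_of_nonneg_right hDX ha0.le
    have b : 2 * Real.exp 1 * ‖lam‖ ≤ 6 * ‖lam‖ := mul_le_mul_of_nonneg_right two_e_lt_six.le hT0
    linarith
  have f2pos : 0 ≤ (D : ℝ) * a + 2 * Real.exp 1 * ‖lam‖ + 6 := by positivity
  have f3 : 33 / 10 * (D : ℝ) * Real.log ((D : ℝ) + 2) + 1 ≤
      33 / 10 * ((n : ℝ) * d) * ((n : ℝ) * d + 1) + 1 := by
    have := mul_le_mul hDX hlogD2 hlogD20 (by positivity)
    nlinarith
  have f3pos : 0 ≤ 33 / 10 * (D : ℝ) * Real.log ((D : ℝ) + 2) + 1 := by positivity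
  have hprod : 211 * (D : ℝ) *
        (Real.log L + Real.log a + 4 * Real.log D + 2 * Real.log (Real.exp 1 * max 1 ‖lam‖) + 10) *
        ((D : ℝ) * a + 2 * Real.exp 1 * ‖lam‖ + 6) *
        (33 / 10 * (D : ℝ) * Real.log ((D : ℝ) + 2) + 1) ≤
      211 * ((n : ℝ) * d) * (Real.log L + Real.log a + 4 * ((n : ℝ) * d) + 2 * ‖lam‖ + 12) *
        (((n : ℝ) * d) * a + 6 * ‖lam‖ + 6) * (33 / 10 * ((n : ℝ) * d) * ((n : ℝ) * d + 1) + 1) := by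
    gcongr
  have hφ1 : 211 * ((n : ℝ) * d) * (Real.log L + Real.log a + 4 * ((n : ℝ) * d) + 2 * ‖lam‖ + 12) *
        (((n : ℝ) * d) * a + 6 * ‖lam‖ + 6) * (33 / 10 * ((n : ℝ) * d) * ((n : ℝ) * d + 1) + 1) ≤
      lphi n a ‖lam‖ |Real.log ‖lam‖| d L := by
    unfold lphi; linarith
  linarith

/-- **Transcendence measure for `λ`, `e^λ ∈ ℚ̄^×` (mod NW 1996 Thm 1)**, via Fel'dman's
transference (tree: `transcendenceMeasure_of_approximationMeasure`). -/
theorem log_measure (hNW : NesterenkoWaldschmidt1996_thm_1) {lam : ℂ} (h0 : lam ≠ 0)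
    {A : ℤ[X]} (hAirr : Irreducible A) (hAdeg : 0 < A.natDegree) (hAα : aeval (cexp lam) A = 0)
    (S : ℤ[X]) (hS : S ≠ 0) {d : ℕ} (hd : 1 ≤ d) (hdeg : S.natDegree ≤ d) {L : ℕ}
    (hlen : (∑ k ∈ Finset.range (S.natDegree + 1), |S.coeff k|) ≤ (L : ℤ)) (hL : 3 ≤ L) :
    Real.exp (-(d * (lphi A.natDegree (Real.log (A.map (Int.castRingHom ℂ)).mahlerMeasure + 1)
      ‖lam‖ |Real.log ‖lam‖| d (2 ^ d * L) + Real.log (2 * d * L)))) ≤ ‖aeval lam S‖ := by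
  have hMA1 : 1 ≤ (A.map (Int.castRingHom ℂ)).mahlerMeasure :=
    one_le_mahlerMeasure_map_of_ne_zero' hAirr.ne_zero
  have ha1 : 1 ≤ Real.log (A.map (Int.castRingHom ℂ)).mahlerMeasure + 1 := by
    linarith [Real.log_nonneg hMA1]
  have h := NesterenkoWaldschmidt1996.transcendenceMeasure_of_approximationMeasure lam
    (lphi A.natDegree (Real.log (A.map (Int.castRingHom ℂ)).mahlerMeasure + 1) ‖lam‖ |Real.log ‖lam‖|)
    (fun m L => lphi_nonneg _ ha1 (norm_nonneg _) (abs_nonneg _) m L)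
    (fun m d L h => lphi_mono _ ha1 (norm_nonneg _) (abs_nonneg _) L h)
    (fun Q ξ L hQ hn hξ hlen hL => log_approx hNW h0 hAirr hAdeg hAα Q ξ L hQ hn hξ hlen hL)
    S hS d L hd hdeg hlen hL
  exact_mod_cast h

/-- the logarithm's exponent is `≤ c (N + log H)^6`, `c = (1688 (a + 2T + 18)(a + 6T + 6) + ℓ + 4) n^6`. -/
theorem log_exponent_le {n a T ℓ N X LgL Lg2 : ℝ} (hn : 1 ≤ n) (ha : 1 ≤ a) (hT : 0 ≤ T)
    (hℓ : 0 ≤ ℓ) (hX1 : 1 ≤ X) (hN0 : 0 ≤ N) (hNX : N ≤ X) (hLgL0 : 0 ≤ LgL) (hLgL : LgL ≤ 2 * X)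
    (hLg20 : 0 ≤ Lg2) (hLg2 : Lg2 ≤ 3 * X) :
    N * ((211 * (n * N) * (LgL + Real.log a + 4 * (n * N) + 2 * T + 12) * ((n * N) * a + 6 * T + 6) *
        (33 / 10 * (n * N) * (n * N + 1) + 1) + 1 + ℓ) + Lg2) ≤
      (1688 * (a + 2 * T + 18) * (a + 6 * T + 6) + ℓ + 4) * n ^ 6 * X ^ 6 := by
  obtain ⟨Y, hY⟩ : ∃ Y : ℝ, Y = n * X := ⟨_, rfl⟩
  have hX0 : 0 ≤ X := by linarith
  have hn0 : 0 ≤ n := by linarith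
  have hXY : X ≤ Y := by rw [hY]; nlinarith
  have hY1 : 1 ≤ Y := hX1.trans hXY
  have hY0 : 0 ≤ Y := by linarith
  have hnNY : n * N ≤ Y := by rw [hY]; exact mul_le_mul_of_nonneg_left hNX hn0
  have hnN0 : 0 ≤ n * N := by positivity
  have hla : Real.log a ≤ a := log_le_self_of_pos' (by linarith)
  have hla0 : 0 ≤ Real.log a := Real.log_nonneg ha
  have ha0 : 0 ≤ a := by linarith
  have hY2 : Y ≤ Y ^ 2 := by nlinarith
  have hY5 : (1 : ℝ) ≤ Y ^ 5 := one_le_pow₀ hY1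
  have hYY5 : Y ≤ Y ^ 5 := by
    calc Y = Y ^ 1 := (pow_one Y).symm
      _ ≤ Y ^ 5 := pow_le_pow_right₀ hY1 (by norm_num)
  -- f1 ≤ (a + 2T + 18) Y
  have hf1 : LgL + Real.log a + 4 * (n * N) + 2 * T + 12 ≤ (a + 2 * T + 18) * Y := by
    have e1 : a ≤ a * Y := le_mul_of_one_le_right ha0 hY1
    have e2 : 2 * T ≤ 2 * T * Y := le_mul_of_one_le_right (by positivity) hY1
    nlinarith
  have hf10 : 0 ≤ LgL + Real.log a + 4 * (n * N) + 2 * T + 12 := by positivity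
  -- f2 ≤ (a + 6T + 6) Y
  have hf2 : (n * N) * a + 6 * T + 6 ≤ (a + 6 * T + 6) * Y := by
    have e1 : (n * N) * a ≤ Y * a := mul_le_mul_of_nonneg_right hnNY ha0
    have e2 : 6 * T + 6 ≤ (6 * T + 6) * Y := le_mul_of_one_le_right (by positivity) hY1
    nlinarith
  have hf20 : 0 ≤ (n * N) * a + 6 * T + 6 := by positivity
  -- f3 ≤ 8 Y²
  have hf3 : 33 / 10 * (n * N) * (n * N + 1) + 1 ≤ 8 * Y ^ 2 := by
    have e1 : (n * N) * (n * N + 1) ≤ Y * (Y + Y) :=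
      mul_le_mul hnNY (by linarith) (by positivity) hY0
    nlinarith
  have hf30 : 0 ≤ 33 / 10 * (n * N) * (n * N + 1) + 1 := by positivity
  have hmain : 211 * (n * N) * (LgL + Real.log a + 4 * (n * N) + 2 * T + 12) *
      ((n * N) * a + 6 * T + 6) * (33 / 10 * (n * N) * (n * N + 1) + 1) ≤
      211 * Y * ((a + 2 * T + 18) * Y) * ((a + 6 * T + 6) * Y) * (8 * Y ^ 2) := by
    refine mul_le_mul (mul_le_mul (mul_le_mul (mul_le_mul_of_nonneg_left hnNY (by norm_num))
      hf1 hf10 (by positivity)) hf2 hf20 (by positivity)) hf3 hf30 (by positivity)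
  have hK0 : 0 ≤ 1688 * (a + 2 * T + 18) * (a + 6 * T + 6) := by positivity
  have e1 : 211 * Y * ((a + 2 * T + 18) * Y) * ((a + 6 * T + 6) * Y) * (8 * Y ^ 2) =
      1688 * (a + 2 * T + 18) * (a + 6 * T + 6) * Y ^ 5 := by ring
  rw [e1] at hmain
  have hℓY : ℓ ≤ ℓ * Y ^ 5 := le_mul_of_one_le_right hℓ hY5
  have hbr : 211 * (n * N) * (LgL + Real.log a + 4 * (n * N) + 2 * T + 12) *
      ((n * N) * a + 6 * T + 6) * (33 / 10 * (n * N) * (n * N + 1) + 1) + 1 + ℓ + Lg2 ≤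
      (1688 * (a + 2 * T + 18) * (a + 6 * T + 6) + ℓ + 4) * Y ^ 5 := by
    nlinarith
  have hbr0 : 0 ≤ 211 * (n * N) * (LgL + Real.log a + 4 * (n * N) + 2 * T + 12) *
      ((n * N) * a + 6 * T + 6) * (33 / 10 * (n * N) * (n * N + 1) + 1) + 1 + ℓ + Lg2 := by
    positivity
  have hNY : N ≤ Y := hNX.trans hXY
  calc N * ((211 * (n * N) * (LgL + Real.log a + 4 * (n * N) + 2 * T + 12) *
        ((n * N) * a + 6 * T + 6) * (33 / 10 * (n * N) * (n * N + 1) + 1) + 1 + ℓ) + Lg2)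
      = N * (211 * (n * N) * (LgL + Real.log a + 4 * (n * N) + 2 * T + 12) *
        ((n * N) * a + 6 * T + 6) * (33 / 10 * (n * N) * (n * N + 1) + 1) + 1 + ℓ + Lg2) := by ring
    _ ≤ Y * ((1688 * (a + 2 * T + 18) * (a + 6 * T + 6) + ℓ + 4) * Y ^ 5) :=
        mul_le_mul hNY hbr hbr0 hY0
    _ = (1688 * (a + 2 * T + 18) * (a + 6 * T + 6) + ℓ + 4) * Y ^ 6 := by ring
    _ = (1688 * (a + 2 * T + 18) * (a + 6 * T + 6) + ℓ + 4) * n ^ 6 * X ^ 6 := by rw [hY]; ring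

/-- **Instance LOG (NW).** `λ ≠ 0` with `e^λ = α` algebraic has finite transcendence type (`τ = 6`),
mod NW 1996 Theorem 1 ALONE (the registered Literature fact `NesterenkoWaldschmidt1996_thm_1`). -/
theorem finiteTranscendenceType_log (hNW : NesterenkoWaldschmidt1996_thm_1) {lam : ℂ} (h0 : lam ≠ 0)
    (halg : IsAlgebraic ℚ (cexp lam)) : FiniteTranscendenceType lam := by
  obtain ⟨A, hAirr, hAdeg, hAα⟩ := NesterenkoWaldschmidt1996.exists_irreducible_int_aeval_eq_zero halg
  obtain ⟨a, ha⟩ : ∃ a : ℝ, a = Real.log (A.map (Int.castRingHom ℂ)).mahlerMeasure + 1 := ⟨_, rfl⟩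
  obtain ⟨T, hT⟩ : ∃ T : ℝ, T = ‖lam‖ := ⟨_, rfl⟩
  obtain ⟨ℓ, hℓ⟩ : ∃ ℓ : ℝ, ℓ = |Real.log ‖lam‖| := ⟨_, rfl⟩
  obtain ⟨n, hn⟩ : ∃ n : ℝ, n = (A.natDegree : ℝ) := ⟨_, rfl⟩
  have hMA1 : 1 ≤ (A.map (Int.castRingHom ℂ)).mahlerMeasure :=
    one_le_mahlerMeasure_map_of_ne_zero' hAirr.ne_zero
  have ha1 : 1 ≤ a := by rw [ha]; linarith [Real.log_nonneg hMA1]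
  have hT0 : 0 ≤ T := hT ▸ norm_nonneg _
  have hℓ0 : 0 ≤ ℓ := hℓ ▸ abs_nonneg _
  have hn1 : 1 ≤ n := by rw [hn]; exact_mod_cast hAdeg
  refine ⟨(1688 * (a + 2 * T + 18) * (a + 6 * T + 6) + ℓ + 4) * n ^ 6, 6,
    by have : (0 : ℝ) ≤ a := by linarith
       positivity,
    fun S N H hS hN hdeg hH hcoef => ?_⟩
  have hlen := sum_abs_coeff_le hdeg hcoef
  have hL3 : 3 ≤ (N + 1) * H := by nlinarith
  have h := log_measure hNW h0 hAirr hAdeg hAα S hS hN hdeg hlen hL3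
  rw [← ha] at h
  refine le_trans (Real.exp_le_exp.mpr ?_) h
  rw [neg_le_neg_iff]
  have hN1 : (1 : ℝ) ≤ N := by exact_mod_cast hN
  have hN0 : (0 : ℝ) < N := by linarith
  have hH16 : (16 : ℝ) ≤ H := by exact_mod_cast hH
  have hH0 : (0 : ℝ) < H := by linarith
  have hlogH0 : 0 ≤ Real.log H := Real.log_nonneg (by linarith)
  obtain ⟨X, hX⟩ : ∃ X : ℝ, X = (N : ℝ) + Real.log H := ⟨_, rfl⟩
  have hX1 : 1 ≤ X := by rw [hX]; linarith
  have hNX : (N : ℝ) ≤ X := by rw [hX]; linarith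
  have hl2 : Real.log 2 ≤ 1 := by linarith [Real.log_two_lt_d9]
  have hlogN : Real.log N ≤ N := log_le_self_of_pos' hN0
  have hlogN1 : Real.log ((N : ℝ) + 1) ≤ N := by
    have := Real.log_le_sub_one_of_pos (by linarith : (0 : ℝ) < N + 1); linarith
  have hL0 : (0 : ℝ) < ((N : ℝ) + 1) * H := by positivity
  have hlogL : Real.log (((N : ℝ) + 1) * H) ≤ X := by
    rw [Real.log_mul (by linarith) hH0.ne', hX]; linarith
  have hlogN0 : 0 ≤ Real.log N := Real.log_nonneg hN1
  have hlogL0 : 0 ≤ Real.log (((N : ℝ) + 1) * H) := Real.log_nonneg (by nlinarith)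
  have e1 : Real.log ((2 : ℝ) ^ N * (((N : ℝ) + 1) * H)) = N * Real.log 2 +
      Real.log (((N : ℝ) + 1) * H) := by
    rw [Real.log_mul (by positivity) hL0.ne', Real.log_pow]
  have e2 : Real.log (2 * (N : ℝ) * (((N : ℝ) + 1) * H)) = Real.log 2 + Real.log N +
      Real.log (((N : ℝ) + 1) * H) := by
    rw [Real.log_mul (by positivity) hL0.ne', Real.log_mul (by norm_num) hN0.ne']
  have hlog2pos : 0 < Real.log 2 := Real.log_pos (by norm_num)
  have hLgL : Real.log ((2 : ℝ) ^ N * (((N : ℝ) + 1) * H)) ≤ 2 * X := by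
    rw [e1]; have := mul_le_mul_of_nonneg_left hl2 hN0.le; linarith
  have hLgL0 : 0 ≤ Real.log ((2 : ℝ) ^ N * (((N : ℝ) + 1) * H)) := by
    rw [e1]; positivity
  have hLg2 : Real.log (2 * (N : ℝ) * (((N : ℝ) + 1) * H)) ≤ 3 * X := by rw [e2]; linarith
  have hLg20 : 0 ≤ Real.log (2 * (N : ℝ) * (((N : ℝ) + 1) * H)) := by
    rw [e2]; positivity
  have hm := log_exponent_le hn1 ha1 hT0 hℓ0 hX1 hN0.le hNX hLgL0 hLgL hLg20 hLg2
  rw [hT, hℓ, hn] at hm ⊢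
  rw [hX] at hm
  unfold lphi
  push_cast
  linarith [hm]

end LogInstance

end Summit.Schanuel.Schanuel.Theorems.RootDecomp1KKummerClosure
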